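import Literature.Geometry.Lorentzian.TeukolskyOutgoingFormalSeries
import Literature.Geometry.Lorentzian.TeukolskyRadialContinuation
import Literature.Analysis.ODE.VariationOfParametersIoi
import HarnessLib

/-!
# Correcting the truncated outgoing series to an exact radial solution (Teixeira da Costa 2020,
# Lemma 2.2, `s = 0`): `R_N = P_N − e_N` with `e_N = O(r^{2p−N})`

Namespace `Literature.Geometry.Lorentzian.Kerr.Costa2019`. Second step of the existence of the solution
normalised at `𝓘⁺` (`TeukolskyNormalisedInfinityExists.lean`). By `TeukolskyOutgoingFormalSeries.lean` the
partial sum `P_N = e^{iωr} r^{2iMω} Σ_{k≤N} cₖ r^{−k−1}` of the formal outgoing series satisfies the scalar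
radial Teukolsky ODE up to a residual `h_N = O(r^{−N−1})`. Here:

* `continuousOn_outgoingPDeriv2`, `outgoingP_sub_le` — continuity of `P_N″` on `(0, ∞)` and the sizes
  `‖P_{N′} − P_N‖, ‖P_{N′}′ − P_N′‖ ≤ C r^{−N−2}` (`N ≤ N′`, `r ≥ 1`);
* `exists_corrected_truncation` — THE CORRECTION: with a basis `y₁, y₂` of radial solutions of polynomial
  growth `O(r^p)` (`exists_rpow_bound_of_isRadialTeukolskySolution`; Wronskian `Δ₀/Δ`,
  `delta_mul_wronskian_eq`) and the particular solution of `y″ = p y′ + q y + h_N/Δ` given by variation of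
  parameters with tails (`Literature.Analysis.ODE.hasDerivAt_varParams_Ioi`),
  `e_N = y₁ ∫_r^∞ y₂ h_N/Δ₀ − y₂ ∫_r^∞ y₁ h_N/Δ₀ = O(r^{2p−N})` (`N > p`), the function `P_N − e_N` solves the
  radial ODE on a half-line and is continued to `(r₊, ∞)` (`radial_extend`): for every `N > p` an exact
  classical solution `S` with `S − P_N, S′ − P_N′ = O(r^{2p−N})`.

Everything is proved. The exponent loss `2p` (crude growth bounds) is harmless: the orders are shifted in
the final assembly.

## References
* R. Teixeira da Costa, CMP 378 (2020) 705–781 = arXiv:1910.02854, Def. 2.3, Lemma 2.2. [Costa2019]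
* E. A. Coddington, N. Levinson, *Theory of Ordinary Differential Equations* (1955), Ch. 3 §8.
  [CoddingtonLevinson1955]
-/

noncomputable section

open Complex Set Filter MeasureTheory Finset

namespace Literature.Geometry.Lorentzian.Kerr

namespace Costa2019

/-! ### The `s = 0` potential and continuity of the truncations -/

/-- For `s = 0` the potential is `V = K²/Δ − (λ + a²ω² − 2amω)`. [cite: Costa2019, §2.2.3 (radial ODE)] -/
theorem radialV_zero (M a ω m lam r : ℝ) :
    radialV M a 0 ω m lam r = (((radialK a ω m r) ^ 2 : ℝ) : ℂ) / (delta M a r : ℂ) -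
      ((lam + a ^ 2 * ω ^ 2 - 2 * a * m * ω : ℝ) : ℂ) := by
  unfold radialV; push_cast; ring

/-- Continuity of `P_N`, `P_N′`, `P_N″` on `(0, ∞)`. [folklore] -/
theorem continuousOn_outgoingPDeriv2 (M ω : ℝ) (c : ℕ → ℂ) (N : ℕ) :
    ContinuousOn (outgoingP M 0 ω c N) (Ioi 0) ∧ ContinuousOn (outgoingPDeriv M 0 ω c N) (Ioi 0) ∧
      ContinuousOn (outgoingPDeriv2 M 0 ω c N) (Ioi 0) := by
  have hP : ContinuousOn (outgoingP M 0 ω c N) (Ioi 0) := fun r hr =>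
    (hasDerivAt_outgoingP M 0 ω c N hr).continuousAt.continuousWithinAt
  have hP1 : ContinuousOn (outgoingPDeriv M 0 ω c N) (Ioi 0) := fun r hr =>
    (hasDerivAt_outgoingPDeriv M 0 ω c N hr).continuousAt.continuousWithinAt
  have hS : ContinuousOn (outgoingSum 0 c N) (Ioi 0) := fun r hr =>
    (hasDerivAt_outgoingSum 0 c N hr).continuousAt.continuousWithinAt
  have hS1 : ContinuousOn (outgoingSumDeriv 0 c N) (Ioi 0) := fun r hr =>
    (hasDerivAt_outgoingSumDeriv 0 c N hr).continuousAt.continuousWithinAt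
  have hrp : ∀ q : ℝ, ContinuousOn (fun r : ℝ => r ^ q) (Ioi 0) := fun q =>
    continuousOn_id.rpow_const fun x hx => Or.inl (ne_of_gt hx)
  have hS2 : ContinuousOn (outgoingSumDeriv2 0 c N) (Ioi 0) := by
    unfold outgoingSumDeriv2
    refine continuousOn_finsetSum _ fun k _ => continuousOn_const.mul ?_
    exact Complex.continuous_ofReal.comp_continuousOn (continuousOn_const.mul (hrp _))
  have hlog : ContinuousOn (fun r : ℝ => ((Real.log r : ℝ) : ℂ)) (Ioi 0) :=
    Complex.continuous_ofReal.comp_continuousOn (Real.continuousOn_log.mono fun x hx => ne_of_gt hx)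
  have hΦ : ContinuousOn (outgoingPhase M ω) (Ioi 0) := by
    unfold outgoingPhase
    exact Complex.continuous_exp.comp_continuousOn
      ((continuous_const.mul Complex.continuous_ofReal).continuousOn.add (continuousOn_const.mul hlog))
  have hinv : ContinuousOn (fun r : ℝ => (r : ℂ)⁻¹) (Ioi 0) :=
    Complex.continuous_ofReal.continuousOn.inv₀ fun x hx => by exact_mod_cast (ne_of_gt hx)
  have hθ : ContinuousOn (fun r : ℝ => I * ω + 2 * I * M * ω * (r : ℂ)⁻¹) (Ioi 0) :=
    continuousOn_const.add (continuousOn_const.mul hinv)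
  refine ⟨hP, hP1, ?_⟩
  unfold outgoingPDeriv2
  exact hΦ.mul (((((hθ.pow 2).sub (continuousOn_const.mul (hinv.pow 2))).mul hS).add
    ((continuousOn_const.mul hθ).mul hS1)).add hS2)

/-- **Tails of the series: `‖P_{N′} − P_N‖, ‖P_{N′}′ − P_N′‖ ≤ C r^{−N−2}`** for `N ≤ N′`, `r ≥ 1`.
[cite: Costa2019, Def. 2.3 (footnote)] -/
theorem outgoingP_sub_le (M ω : ℝ) (c : ℕ → ℂ) {N N' : ℕ} (hNN : N ≤ N') :
    ∃ C : ℝ, 0 ≤ C ∧ ∀ r : ℝ, 1 ≤ r →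
      ‖outgoingP M 0 ω c N' r - outgoingP M 0 ω c N r‖ ≤ C * r ^ (-(N : ℝ) - 2) ∧
        ‖outgoingPDeriv M 0 ω c N' r - outgoingPDeriv M 0 ω c N r‖ ≤ C * r ^ (-(N : ℝ) - 2) := by
  set B : ℝ := ∑ k ∈ range (N' + 1), ‖c k‖ with hB
  have hB0 : 0 ≤ B := Finset.sum_nonneg fun _ _ => norm_nonneg _
  refine ⟨((1 + 2 * |M|) * |ω| + (N' + 2) + 1) * B, by positivity, fun r hr => ?_⟩
  have hr0 : 0 < r := by linarith
  -- the two amplitude differences as sums over `N < k ≤ N'`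
  have hdS : outgoingSum 0 c N' r - outgoingSum 0 c N r =
      ∑ k ∈ Finset.Ico (N + 1) (N' + 1), c k * ((r ^ (-(2 * (0 : ℝ)) - (k : ℝ) - 1) : ℝ) : ℂ) := by
    unfold outgoingSum; rw [Finset.sum_Ico_eq_sub _ (by omega)]
  have hdS1 : outgoingSumDeriv 0 c N' r - outgoingSumDeriv 0 c N r = ∑ k ∈ Finset.Ico (N + 1) (N' + 1),
      c k * (((-(2 * (0 : ℝ)) - (k : ℝ) - 1) * r ^ (-(2 * (0 : ℝ)) - (k : ℝ) - 2) : ℝ) : ℂ) := by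
    unfold outgoingSumDeriv; rw [Finset.sum_Ico_eq_sub _ (by omega)]
  have hk : ∀ k ∈ Finset.Ico (N + 1) (N' + 1), ‖c k * ((r ^ (-(2 * (0 : ℝ)) - (k : ℝ) - 1) : ℝ) : ℂ)‖ ≤
      ‖c k‖ * r ^ (-(N : ℝ) - 2) ∧
      ‖c k * (((-(2 * (0 : ℝ)) - (k : ℝ) - 1) * r ^ (-(2 * (0 : ℝ)) - (k : ℝ) - 2) : ℝ) : ℂ)‖ ≤
        (N' + 2) * (‖c k‖ * r ^ (-(N : ℝ) - 2)) := by
    intro k hk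
    rw [Finset.mem_Ico] at hk
    have hk1 : (N : ℝ) + 1 ≤ k := by exact_mod_cast hk.1
    have hk2 : (k : ℝ) ≤ N' := by exact_mod_cast Nat.lt_succ_iff.mp hk.2
    have e1 : r ^ (-(2 * (0 : ℝ)) - (k : ℝ) - 1) ≤ r ^ (-(N : ℝ) - 2) :=
      Real.rpow_le_rpow_of_exponent_le hr (by linarith)
    have e2 : r ^ (-(2 * (0 : ℝ)) - (k : ℝ) - 2) ≤ r ^ (-(N : ℝ) - 2) :=
      Real.rpow_le_rpow_of_exponent_le hr (by linarith)
    constructor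
    · rw [norm_mul, Complex.norm_real, Real.norm_of_nonneg (Real.rpow_nonneg hr0.le _)]
      exact mul_le_mul_of_nonneg_left e1 (norm_nonneg _)
    · rw [norm_mul, Complex.norm_real, Real.norm_eq_abs, abs_mul, abs_of_nonneg (Real.rpow_nonneg hr0.le _)]
      have h3 : |(-(2 * (0 : ℝ)) - (k : ℝ) - 1)| ≤ N' + 2 := by
        rw [abs_le]; constructor <;> linarith
      calc ‖c k‖ * (|(-(2 * (0 : ℝ)) - (k : ℝ) - 1)| * r ^ (-(2 * (0 : ℝ)) - (k : ℝ) - 2))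
          ≤ ‖c k‖ * ((N' + 2) * r ^ (-(N : ℝ) - 2)) :=
            mul_le_mul_of_nonneg_left (mul_le_mul h3 e2 (Real.rpow_nonneg hr0.le _) (by positivity))
              (norm_nonneg _)
        _ = (N' + 2) * (‖c k‖ * r ^ (-(N : ℝ) - 2)) := by ring
  have hsub : (∑ k ∈ Finset.Ico (N + 1) (N' + 1), ‖c k‖) ≤ B := by
    refine Finset.sum_le_sum_of_subset_of_nonneg ?_ fun _ _ _ => norm_nonneg _
    rw [Finset.range_eq_Ico]
    exact Finset.Ico_subset_Ico_left (Nat.zero_le _)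
  have hD : ‖outgoingSum 0 c N' r - outgoingSum 0 c N r‖ ≤ B * r ^ (-(N : ℝ) - 2) := by
    rw [hdS]
    refine (norm_sum_le _ _).trans ((Finset.sum_le_sum fun k hk' => (hk k hk').1).trans ?_)
    rw [← Finset.sum_mul]
    exact mul_le_mul_of_nonneg_right hsub (Real.rpow_nonneg hr0.le _)
  have hD1 : ‖outgoingSumDeriv 0 c N' r - outgoingSumDeriv 0 c N r‖ ≤ (N' + 2) * (B * r ^ (-(N : ℝ) - 2)) := by
    rw [hdS1]
    refine (norm_sum_le _ _).trans ((Finset.sum_le_sum fun k hk' => (hk k hk').2).trans ?_)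
    rw [← Finset.mul_sum, ← Finset.sum_mul]
    exact mul_le_mul_of_nonneg_left (mul_le_mul_of_nonneg_right hsub (Real.rpow_nonneg hr0.le _)) (by positivity)
  have hθ : ‖I * ω + 2 * I * M * ω * (r : ℂ)⁻¹‖ ≤ (1 + 2 * |M|) * |ω| := by
    refine (norm_add_le _ _).trans ?_
    have hri : ‖(r : ℂ)⁻¹‖ ≤ 1 := by
      rw [norm_inv, Complex.norm_real, Real.norm_of_nonneg hr0.le]; exact inv_le_one_of_one_le₀ hr
    rw [norm_mul, Complex.norm_I, one_mul, Complex.norm_real, Real.norm_eq_abs]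
    have : ‖2 * I * M * ω * (r : ℂ)⁻¹‖ ≤ 2 * |M| * |ω| := by
      rw [norm_mul, norm_mul, norm_mul, norm_mul, Complex.norm_I, Complex.norm_real, Complex.norm_real,
        Real.norm_eq_abs, Real.norm_eq_abs, Complex.norm_ofNat]
      calc 2 * 1 * |M| * |ω| * ‖(r : ℂ)⁻¹‖ ≤ 2 * 1 * |M| * |ω| * 1 :=
            mul_le_mul_of_nonneg_left hri (by positivity)
        _ = 2 * |M| * |ω| := by ring
    linarith
  have hΦ := norm_outgoingPhase M ω r
  have hx0 : 0 ≤ B * r ^ (-(N : ℝ) - 2) := by positivity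
  constructor
  · have e : outgoingP M 0 ω c N' r - outgoingP M 0 ω c N r =
        outgoingPhase M ω r * (outgoingSum 0 c N' r - outgoingSum 0 c N r) := by unfold outgoingP; ring
    rw [e, norm_mul, hΦ, one_mul]
    refine hD.trans ?_
    have : B * r ^ (-(N : ℝ) - 2) * 1 ≤ B * r ^ (-(N : ℝ) - 2) * ((1 + 2 * |M|) * |ω| + (N' + 2) + 1) :=
      mul_le_mul_of_nonneg_left (by nlinarith [abs_nonneg M, abs_nonneg ω, mul_nonneg (abs_nonneg M) (abs_nonneg ω)]) hx0
    linarith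
  · have e : outgoingPDeriv M 0 ω c N' r - outgoingPDeriv M 0 ω c N r = outgoingPhase M ω r *
        ((I * ω + 2 * I * M * ω * (r : ℂ)⁻¹) * (outgoingSum 0 c N' r - outgoingSum 0 c N r) +
          (outgoingSumDeriv 0 c N' r - outgoingSumDeriv 0 c N r)) := by unfold outgoingPDeriv; ring
    rw [e, norm_mul, hΦ, one_mul]
    refine (norm_add_le _ _).trans ?_
    rw [norm_mul]
    have h1 := mul_le_mul hθ hD (norm_nonneg _) (by positivity)
    nlinarith [h1, hD1, hx0]

/-! ### The corrected truncations -/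

/-- **EXACT SOLUTIONS ASYMPTOTIC TO THE TRUNCATED OUTGOING SERIES.** For `M > 0`, `|a| < M`, `ω ≠ 0`,
`m, λ`, `c₀`: there are `p ≥ 0` and `X ≥ 2r₊ + 1` such that for every order `N > p` the scalar radial
Teukolsky ODE has a classical solution `S` on `(r₊, ∞)` (in normal form, with derivative `S′`) with
`‖S − P_N‖, ‖S′ − P_N′‖ ≤ K r^{2p−N}` for `r > X`, where `P_N = outgoingP M 0 ω c N`,
`c = outgoingCoeff M a ω m λ c₀`. (`S = P_N − e_N`, `e_N` the variation-of-parameters particular solution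
of the residual equation with data at `+∞`, built on a basis of growth `O(r^p)`.)
[cite: Costa2019, Lemma 2.2] -/
theorem exists_corrected_truncation {M a : ℝ} (hM : 0 < M) (ha : |a| < M) {ω : ℝ} (hω : ω ≠ 0)
    (m lam : ℝ) (c₀ : ℂ) :
    ∃ p X : ℝ, 0 ≤ p ∧ 2 * rPlus M a + 1 ≤ X ∧ ∀ N : ℕ, p < N →
      ∃ S S' : ℝ → ℂ, (∀ t ∈ Ioi (rPlus M a), HasDerivAt S (S' t) t ∧
        HasDerivAt S' (radialNFp M a 0 t * S' t + radialNFq M a 0 ω m lam t * S t) t) ∧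
        ∃ K : ℝ, ∀ x : ℝ, X < x →
          ‖S x - outgoingP M 0 ω (outgoingCoeff M a ω m lam c₀) N x‖ ≤ K * x ^ (2 * p - N) ∧
          ‖S' x - outgoingPDeriv M 0 ω (outgoingCoeff M a ω m lam c₀) N x‖ ≤ K * x ^ (2 * p - N) := by
  set c := outgoingCoeff M a ω m lam c₀ with hc
  have hrp : 0 < rPlus M a := rPlus_pos hM a
  set t₀ : ℝ := 2 * rPlus M a + 1 with ht₀
  have ht₀p : rPlus M a < t₀ := by rw [ht₀]; linarith
  have hΔ₀ : 0 < delta M a t₀ := delta_pos ha.le ht₀p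
  have hΔ₀' : (delta M a t₀ : ℂ) ≠ 0 := by exact_mod_cast hΔ₀.ne'
  -- the basis
  obtain ⟨y₁, y₁', h10, h11, hy₁⟩ := exists_radial_of_data ha.le 0 ω m lam t₀ 1 0
  obtain ⟨y₂, y₂', h20, h21, hy₂⟩ := exists_radial_of_data ha.le 0 ω m lam t₀ 0 1
  obtain ⟨X₁, C₁, p₁, -, hX₁, hC₁, hp₁, hb₁⟩ := exists_rpow_bound_of_isRadialTeukolskySolution hM ha hω
    (isRadialTeukolskySolution_of_normalForm ha.le hy₁) fun r hr => (hy₁ r hr).1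
  obtain ⟨X₂, C₂, p₂, -, hX₂, hC₂, hp₂, hb₂⟩ := exists_rpow_bound_of_isRadialTeukolskySolution hM ha hω
    (isRadialTeukolskySolution_of_normalForm ha.le hy₂) fun r hr => (hy₂ r hr).1
  have hW : ∀ t, rPlus M a < t → (delta M a t : ℂ) * (y₁ t * y₂' t - y₁' t * y₂ t) = delta M a t₀ := by
    intro t ht
    rw [delta_mul_wronskian_eq ha.le hy₁ hy₂ ht ht₀p, h10, h11, h20, h21]; ring
  set p := max p₁ p₂ with hp
  set Cb := max C₁ C₂ with hCb
  set X := max (max X₁ X₂) t₀ with hX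
  have hX1 : 1 ≤ X := hX₁.trans ((le_max_left _ _).trans (le_max_left _ _))
  have hX0 : 0 < X := one_pos.trans_le hX1
  have hXt : t₀ ≤ X := le_max_right _ _
  have hXr : rPlus M a < X := ht₀p.trans_le hXt
  have hCb0 : 0 ≤ Cb := hC₁.trans (le_max_left _ _)
  have hyb : ∀ x, X ≤ x → (‖y₁ x‖ ≤ Cb * x ^ p ∧ ‖y₁' x‖ ≤ Cb * x ^ p) ∧ (‖y₂ x‖ ≤ Cb * x ^ p ∧ ‖y₂' x‖ ≤ Cb * x ^ p) := by
    intro x hx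
    have hx1 : 1 ≤ x := hX1.trans hx
    have hxX₁ : X₁ ≤ x := ((le_max_left _ _).trans (le_max_left _ _)).trans hx
    have hxX₂ : X₂ ≤ x := ((le_max_right _ _).trans (le_max_left _ _)).trans hx
    have m1 : C₁ * x ^ p₁ ≤ Cb * x ^ p :=
      mul_le_mul (le_max_left _ _) (Real.rpow_le_rpow_of_exponent_le hx1 (le_max_left _ _))
        (Real.rpow_nonneg (by linarith) _) hCb0
    have m2 : C₂ * x ^ p₂ ≤ Cb * x ^ p :=
      mul_le_mul (le_max_right _ _) (Real.rpow_le_rpow_of_exponent_le hx1 (le_max_right _ _))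
        (Real.rpow_nonneg (by linarith) _) hCb0
    exact ⟨⟨(hb₁ x hxX₁).1.trans m1, (hb₁ x hxX₁).2.trans m1⟩, (hb₂ x hxX₂).1.trans m2, (hb₂ x hxX₂).2.trans m2⟩
  refine ⟨p, X, le_max_of_le_left hp₁, hXt, fun N hN => ?_⟩
  -- the residual of `P_N` and the weight `φ = h_N/Δ₀`
  obtain ⟨CN, hCN0, hres⟩ := outgoing_truncation_residual hM ha hω m lam c₀ N
  set P := outgoingP M 0 ω c N with hPdef
  set P' := outgoingPDeriv M 0 ω c N with hP'def
  set P'' := outgoingPDeriv2 M 0 ω c N with hP''def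
  set h : ℝ → ℂ := fun t => (delta M a t : ℂ) * P'' t + 2 * ((t - M : ℝ) : ℂ) * P' t +
    ((((radialK a ω m t) ^ 2 : ℝ) : ℂ) / (delta M a t : ℂ) - ((lam + a ^ 2 * ω ^ 2 - 2 * a * m * ω : ℝ) : ℂ)) * P t
    with hh
  set φ : ℝ → ℂ := fun t => h t / (delta M a t₀ : ℂ) with hφ
  have hIoi : ∀ t ∈ Ioi X, rPlus M a < t ∧ 0 < t ∧ t₀ ≤ t := fun t ht =>
    ⟨hXr.trans ht, hX0.trans ht, hXt.trans ht.le⟩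
  -- continuity of `φ` on `(X, ∞)`
  obtain ⟨hPc, hP'c, hP''c⟩ := continuousOn_outgoingPDeriv2 M ω c N
  have hφc : ContinuousOn φ (Ioi X) := by
    have hΔc : Continuous fun r : ℝ => (delta M a r : ℂ) :=
      Complex.continuous_ofReal.comp (show Continuous fun r : ℝ => r ^ 2 - 2 * M * r + a ^ 2 by fun_prop)
    have hVc : ContinuousOn (fun t => (((radialK a ω m t) ^ 2 : ℝ) : ℂ) / (delta M a t : ℂ) -
        ((lam + a ^ 2 * ω ^ 2 - 2 * a * m * ω : ℝ) : ℂ)) (Ioi X) := by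
      have h := (continuousOn_radialNF ha.le 0 ω m lam).2.mono fun t ht => (hIoi t ht).1
      have e : ∀ t ∈ Ioi X, (((radialK a ω m t) ^ 2 : ℝ) : ℂ) / (delta M a t : ℂ) -
          ((lam + a ^ 2 * ω ^ 2 - 2 * a * m * ω : ℝ) : ℂ) = -(radialNFq M a 0 ω m lam t * (delta M a t : ℂ)) := by
        intro t ht
        have hΔ : (delta M a t : ℂ) ≠ 0 := by exact_mod_cast (delta_pos ha.le (hIoi t ht).1).ne'
        rw [radialNFq, radialV_zero]; field_simp
      exact ContinuousOn.congr ((h.mul hΔc.continuousOn).neg) e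
    have hsub : Ioi X ⊆ Ioi (0 : ℝ) := fun t ht => (hIoi t ht).2.1
    have hrM : Continuous fun t : ℝ => ((t - M : ℝ) : ℂ) := Complex.continuous_ofReal.comp (by fun_prop)
    have hhc : ContinuousOn h (Ioi X) :=
      ((hΔc.continuousOn.mul (hP''c.mono hsub)).add ((continuousOn_const.mul hrM.continuousOn).mul
        (hP'c.mono hsub))).add (hVc.mul (hPc.mono hsub))
    exact hhc.div_const _
  -- the bound `‖yᵢ φ‖ ≤ K₀ t^{−(N+1−p)}` and integrability
  set K₀ : ℝ := Cb * CN / delta M a t₀ with hK₀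
  have hK₀0 : 0 ≤ K₀ := by positivity
  have hq : 1 < (N : ℝ) + 1 - p := by linarith
  have hbd : ∀ (y : ℝ → ℂ), (∀ x, X ≤ x → ‖y x‖ ≤ Cb * x ^ p) → ∀ t, X < t → ‖y t * φ t‖ ≤ K₀ * t ^ (-((N : ℝ) + 1 - p)) := by
    intro y hy t ht
    obtain ⟨htp, ht0, htt⟩ := hIoi t ht
    have h1 := hres t (by linarith [ht₀])
    rw [norm_mul, hφ, norm_div, Complex.norm_real, Real.norm_of_nonneg hΔ₀.le]
    have e : t ^ p * t ^ (-(N : ℝ) - 1) = t ^ (-((N : ℝ) + 1 - p)) := by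
      rw [← Real.rpow_add ht0]; ring_nf
    calc ‖y t‖ * (‖h t‖ / delta M a t₀) ≤ Cb * t ^ p * (CN * t ^ (-(N : ℝ) - 1) / delta M a t₀) :=
          mul_le_mul (hy t ht.le) (div_le_div_of_nonneg_right h1 hΔ₀.le) (by positivity) (by positivity)
      _ = K₀ * (t ^ p * t ^ (-(N : ℝ) - 1)) := by rw [hK₀]; ring
      _ = K₀ * t ^ (-((N : ℝ) + 1 - p)) := by rw [e]
  have hy₁c : ContinuousOn y₁ (Ioi X) := fun t ht => (hy₁ t (hIoi t ht).1).1.continuousAt.continuousWithinAt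
  have hy₂c : ContinuousOn y₂ (Ioi X) := fun t ht => (hy₂ t (hIoi t ht).1).1.continuousAt.continuousWithinAt
  have hb1 := hbd y₁ fun x hx => (hyb x hx).1.1
  have hb2 := hbd y₂ fun x hx => (hyb x hx).2.1
  have hi1 := Literature.Analysis.ODE.integrableOn_Ioi_of_norm_le_rpow_neg hX0 hq (hy₁c.mul hφc) hb1
  have hi2 := Literature.Analysis.ODE.integrableOn_Ioi_of_norm_le_rpow_neg hX0 hq (hy₂c.mul hφc) hb2
  -- the particular solution `e` and the corrected truncation on `(X, ∞)`
  have hvp := fun x (hx : X < x) => Literature.Analysis.ODE.hasDerivAt_varParams_Ioi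
    (fun t ht => hy₁ t (hIoi t ht).1) (fun t ht => hy₂ t (hIoi t ht).1) hφc hi1 hi2 hx
  set e : ℝ → ℂ := fun x => y₁ x * (∫ t in Ioi x, y₂ t * φ t) - y₂ x * ∫ t in Ioi x, y₁ t * φ t with he
  set e' : ℝ → ℂ := fun x => y₁' x * (∫ t in Ioi x, y₂ t * φ t) - y₂' x * ∫ t in Ioi x, y₁ t * φ t with he'
  have hloc : ∀ x ∈ Ioi X, HasDerivAt (fun z => P z - e z) (P' x - e' x) x ∧
      HasDerivAt (fun z => P' z - e' z)
        (radialNFp M a 0 x * (P' x - e' x) + radialNFq M a 0 ω m lam x * (P x - e x)) x := by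
    intro x hx
    obtain ⟨hxp, hx0, -⟩ := hIoi x hx
    obtain ⟨he1, he2⟩ := hvp x hx
    have hΔx : (delta M a x : ℂ) ≠ 0 := by exact_mod_cast (delta_pos ha.le hxp).ne'
    have hd1 := hasDerivAt_outgoingP M 0 ω c N hx0
    have hd2 := hasDerivAt_outgoingPDeriv M 0 ω c N hx0
    refine ⟨hd1.sub he1, (hd2.sub he2).congr_deriv ?_⟩
    have hWx := hW x hxp
    have eφ : (y₁ x * y₂' x - y₁' x * y₂ x) * φ x = h x / (delta M a x : ℂ) := by
      rw [hφ]; field_simp; linear_combination (h x) * hWx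
    rw [eφ]
    have eP : P'' x = radialNFp M a 0 x * P' x + radialNFq M a 0 ω m lam x * P x + h x / (delta M a x : ℂ) := by
      rw [hh, radialNFp, radialNFq, radialV_zero]
      push_cast
      field_simp
      ring
    show outgoingPDeriv2 M 0 ω c N x - (radialNFp M a 0 x * e' x + radialNFq M a 0 ω m lam x * e x +
        h x / (delta M a x : ℂ)) = radialNFp M a 0 x * (P' x - e' x) + radialNFq M a 0 ω m lam x * (P x - e x)
    rw [← hP''def, eP]
    ring
  obtain ⟨S, S', hS, hES, hES'⟩ := radial_extend ha.le 0 ω m lam hXr.le hloc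
  -- sizes of the tails and of `e`, `e′`
  have htail : ∀ (y : ℝ → ℂ), (∀ t, X < t → ‖y t * φ t‖ ≤ K₀ * t ^ (-((N : ℝ) + 1 - p))) →
      ∀ x, X ≤ x → ‖∫ t in Ioi x, y t * φ t‖ ≤ K₀ / ((N : ℝ) + 1 - p - 1) * x ^ (1 - ((N : ℝ) + 1 - p)) :=
    fun y hy x hx => Literature.Analysis.ODE.norm_setIntegral_Ioi_le_of_norm_le_rpow hX0 hq hy hx
  set T : ℝ := K₀ / ((N : ℝ) + 1 - p - 1) with hT
  have hT0 : 0 ≤ T := div_nonneg hK₀0 (by linarith)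
  refine ⟨S, S', hS, 2 * Cb * T, fun x hx => ?_⟩
  obtain ⟨hxp, hx0, -⟩ := hIoi x hx
  have hx' : X ≤ x := hx.le
  have eexp : x ^ p * x ^ (1 - ((N : ℝ) + 1 - p)) = x ^ (2 * p - N) := by
    rw [← Real.rpow_add hx0]; ring_nf
  have hI1 := htail y₁ hb1 x hx'
  have hI2 := htail y₂ hb2 x hx'
  obtain ⟨⟨hy1x, hy1'x⟩, hy2x, hy2'x⟩ := hyb x hx'
  have bound : ∀ u v : ℂ, ‖u‖ ≤ Cb * x ^ p → ‖v‖ ≤ Cb * x ^ p →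
      ‖u * (∫ t in Ioi x, y₂ t * φ t) - v * ∫ t in Ioi x, y₁ t * φ t‖ ≤ 2 * Cb * T * x ^ (2 * p - N) := by
    intro u v hu hv
    calc ‖u * (∫ t in Ioi x, y₂ t * φ t) - v * ∫ t in Ioi x, y₁ t * φ t‖
        ≤ ‖u‖ * ‖∫ t in Ioi x, y₂ t * φ t‖ + ‖v‖ * ‖∫ t in Ioi x, y₁ t * φ t‖ := by
          refine (norm_sub_le _ _).trans ?_; rw [norm_mul, norm_mul]
      _ ≤ Cb * x ^ p * (T * x ^ (1 - ((N : ℝ) + 1 - p))) + Cb * x ^ p * (T * x ^ (1 - ((N : ℝ) + 1 - p))) :=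
          add_le_add (mul_le_mul hu hI2 (norm_nonneg _) (by positivity))
            (mul_le_mul hv hI1 (norm_nonneg _) (by positivity))
      _ = 2 * Cb * T * (x ^ p * x ^ (1 - ((N : ℝ) + 1 - p))) := by ring
      _ = 2 * Cb * T * x ^ (2 * p - N) := by rw [eexp]
  constructor
  · rw [← hES hx, show P x - e x - P x = -(e x) by ring, norm_neg]
    exact bound _ _ hy1x hy2x
  · rw [← hES' hx, show P' x - e' x - P' x = -(e' x) by ring, norm_neg]
    exact bound _ _ hy1'x hy2'x

end Costa2019

end Literature.Geometry.Lorentzian.Kerr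

end
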